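import Literature.Combinatorics.Additive.TripleProductProperty
import Summits.MatrixMultiplication.MatrixMultiplication.Theorems.SnSubsetDichotomyThresholdSubsetTriplesPairFactorisation

/-!
# `SnSubsetDichotomy.ThresholdSubsetTriples` — stub `stub_ownerPairNoThird` via the PACKING CERTIFICATE

Crux `stmt-MatrixMultiplication-10882` (`ThresholdSubsetTriples`), line `interleaved-subsignature-ascent`,
negative design rule of census c3a (siege k24, variation "certificate on the finite core").  The stub itself is
also landed by sibling siege files (`…StubOwnerPairNoThird*.lean`, direct mixed-quotient relation); this file's
own content is the QUANTITATIVE form — the pair-slack inequality and the cardinality certificate below — from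
which the stub follows by linear arithmetic (the stub is re-declared only inside the sub-namespace
`OwnerPairNoThirdK24`, one fully-qualified name per module).

The proof is by a numeric certificate rather than by exhibiting a relation:

* `tpp_card_mul_card_add_card_le` — the PAIR-SLACK INEQUALITY, valid in every finite group: if `(S, T, U)`
  has the triple product property and `U ≠ ∅` then `|S|·|T| + |U| ≤ |G| + 1`.  (The `|S||T|` mixed
  quotients `s₀ s⁻¹ · t t₀⁻¹` are pairwise distinct, the `|U|` quotients `u u₀⁻¹` are pairwise distinct,
  and the two families meet only in `1`; census c3a §3: "the third class lives in the pair's slack".)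
  It refines the single-triple packing bound `|S||T| ≤ |G|` of Blasiak–Church–Cohn–Grochow–Naslund–Sawin–
  Umans 2017, §2, by the additive term `|U| − 1`.
* `card_subsig_ownerSystem_mul_compl` — the CERTIFICATE: the complementary owner chain classes have
  `|S_A|·|S_B| = n!` exactly (the pair map `(a, b) ↦ a⁻¹ b` is a bijection onto `S_n`,
  `stub_pairFactorisation`, landed in `SnSubsetDichotomyThresholdSubsetTriplesPairFactorisation`).
* `stub_ownerPairNoThird` — hence `n! + |U| ≤ n! + 1`, i.e. `|U| ≤ 1`, by linear arithmetic.

Mathlib + the tree's `TripleProductProperty` + the two landed line files only.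
-/

-- `Summit.<Summit>.<Problem>` is the tree's mandated summit-side namespace; for this single-conjunct summit the
-- two components coincide, so the file silences `dupNamespace` (same as the vocabulary file it imports).
set_option linter.dupNamespace false
set_option autoImplicit false

namespace Summit.MatrixMultiplication.MatrixMultiplication.Theorems.ThresholdSubsetTriples

open Literature.Combinatorics.Additive

/-- **Pair-slack inequality.**  In a finite group, a triple `(S, T, U)` with the triple product property and
`U` nonempty satisfies `|S|·|T| + |U| ≤ |G| + 1`: the mixed pair quotients `s₀ s⁻¹ (t t₀⁻¹)` (`|S||T|` of them,
pairwise distinct) and the quotients `u u₀⁻¹` (`|U|` of them) share only the identity.  Refines the packing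
bound `|S||T| ≤ |G|` (Blasiak et al. 2017, §2) by the slack term `|U| − 1`. -/
theorem tpp_card_mul_card_add_card_le {G : Type*} [Group G] [Fintype G] [DecidableEq G]
    {S T U : Finset G} (h : TripleProductProperty S T U) (hU : U.Nonempty) :
    S.card * T.card + U.card ≤ Fintype.card G + 1 := by
  rcases S.eq_empty_or_nonempty with rfl | ⟨s₀, hs₀⟩
  · rw [Finset.card_empty, zero_mul, zero_add]
    exact (Finset.card_le_univ U).trans (Nat.le_succ _)
  rcases T.eq_empty_or_nonempty with rfl | ⟨t₀, ht₀⟩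
  · rw [Finset.card_empty, mul_zero, zero_add]
    exact (Finset.card_le_univ U).trans (Nat.le_succ _)
  obtain ⟨u₀, hu₀⟩ := hU
  -- the two families of quotients
  have hXcard : ((S ×ˢ T).image fun p => s₀ * p.1⁻¹ * (p.2 * t₀⁻¹)).card = S.card * T.card := by
    rw [Finset.card_image_of_injOn, Finset.card_product]
    rintro ⟨s₁, t₁⟩ h₁ ⟨s₂, t₂⟩ h₂ heq
    rw [Finset.coe_product, Set.mem_prod, Finset.mem_coe, Finset.mem_coe] at h₁ h₂
    simp only at heq
    -- `s₀ s₁⁻¹ t₁ t₀⁻¹ = s₀ s₂⁻¹ t₂ t₀⁻¹` gives the TPP relation `s₂ s₁⁻¹ (t₁ t₂⁻¹) (u₀ u₀⁻¹) = 1`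
    have hq : s₁⁻¹ * t₁ = s₂⁻¹ * t₂ := by
      have := congrArg (fun x => s₀⁻¹ * x * t₀) heq
      simpa [mul_assoc] using this
    have hrel : s₂ * s₁⁻¹ * (t₁ * t₂⁻¹) * (u₀ * u₀⁻¹) = 1 := by
      calc s₂ * s₁⁻¹ * (t₁ * t₂⁻¹) * (u₀ * u₀⁻¹) = s₂ * (s₁⁻¹ * t₁) * t₂⁻¹ := by group
        _ = 1 := by rw [hq]; group
    obtain ⟨hs, ht, -⟩ := h s₂ h₂.1 s₁ h₁.1 t₁ h₁.2 t₂ h₂.2 u₀ hu₀ u₀ hu₀ hrel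
    rw [hs, ht]
  have hYcard : (U.image fun u => u * u₀⁻¹).card = U.card :=
    Finset.card_image_of_injective _ (mul_left_injective u₀⁻¹)
  -- they meet only in `1`
  have hXY : ((S ×ˢ T).image fun p => s₀ * p.1⁻¹ * (p.2 * t₀⁻¹)) ∩ (U.image fun u => u * u₀⁻¹) ⊆ {1} := by
    intro x hx
    rw [Finset.mem_inter] at hx
    obtain ⟨hxX, hxY⟩ := hx
    simp only [Finset.mem_image, Finset.mem_product, Prod.exists] at hxX
    obtain ⟨s₁, t₁, ⟨hs₁, ht₁⟩, hx₁⟩ := hxX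
    simp only [Finset.mem_image] at hxY
    obtain ⟨u₁, hu₁, hx₂⟩ := hxY
    have hrel : s₀ * s₁⁻¹ * (t₁ * t₀⁻¹) * (u₀ * u₁⁻¹) = 1 := by
      rw [hx₁, ← hx₂]; group
    obtain ⟨-, -, hu⟩ := h s₀ hs₀ s₁ hs₁ t₁ ht₁ t₀ ht₀ u₀ hu₀ u₁ hu₁ hrel
    rw [Finset.mem_singleton, ← hx₂, hu, mul_inv_cancel]
  have hinter := Finset.card_le_card hXY
  rw [Finset.card_singleton] at hinter
  have hunion := Finset.card_le_univ
    (((S ×ˢ T).image fun p => s₀ * p.1⁻¹ * (p.2 * t₀⁻¹)) ∪ (U.image fun u => u * u₀⁻¹))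
  have hsum := Finset.card_union_add_card_inter
    ((S ×ˢ T).image fun p => s₀ * p.1⁻¹ * (p.2 * t₀⁻¹)) (U.image fun u => u * u₀⁻¹)
  rw [hXcard, hYcard] at hsum
  omega

/-- **The certificate.**  The complementary owner chain classes `S_A = subsig (ownerSystem L)` and
`S_B = subsig (ownerSystem Lᶜ)` have `|S_A|·|S_B| = n!` exactly: the pair map `(a, b) ↦ a⁻¹ b` is a bijection
`S_A × S_B → S_n` (`stub_pairFactorisation`). -/
theorem card_subsig_ownerSystem_mul_compl {n : ℕ} (L : Finset (Fin n)) :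
    (subsig (ownerSystem L)).card * (subsig (ownerSystem Lᶜ)).card = n.factorial := by
  rw [← Finset.card_product]
  have h : (subsig (ownerSystem L) ×ˢ subsig (ownerSystem Lᶜ)).card =
      (Finset.univ : Finset (Equiv.Perm (Fin n))).card :=
    Finset.card_bij (fun p _ => p.1⁻¹ * p.2) (fun p _ => Finset.mem_univ _)
      (fun p₁ h₁ p₂ h₂ heq => by
        rw [Finset.mem_product] at h₁ h₂
        exact (stub_pairFactorisation L (p₁.1⁻¹ * p₁.2)).unique ⟨h₁.1, h₁.2, rfl⟩ ⟨h₂.1, h₂.2, heq.symm⟩)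
      (fun σ _ => by
        obtain ⟨p, ⟨ha, hb, hab⟩, -⟩ := stub_pairFactorisation L σ
        exact ⟨p, Finset.mem_product.2 ⟨ha, hb⟩, hab⟩)
  rw [h, Finset.card_univ, Fintype.card_perm, Fintype.card_fin]

namespace OwnerPairNoThirdK24

/-- **Stub `stub_ownerPairNoThird` (census c3a, negative design rule), by the packing certificate.**  If
`(S_A, S_B, U)` has the triple product property for the complementary owner chain classes
`S_A = subsig (ownerSystem L)`, `S_B = subsig (ownerSystem Lᶜ)`, then `|U| ≤ 1`: the pair-slack inequality
gives `|S_A||S_B| + |U| ≤ n! + 1` and the certificate `|S_A||S_B| = n!` leaves no slack. -/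
theorem stub_ownerPairNoThird {n : ℕ} (L : Finset (Fin n)) (U : Finset (Equiv.Perm (Fin n)))
    (hT : TripleProductProperty (subsig (ownerSystem L)) (subsig (ownerSystem Lᶜ)) U) : U.card ≤ 1 := by
  rcases U.eq_empty_or_nonempty with rfl | hU
  · rw [Finset.card_empty]
    exact Nat.zero_le _
  · have h := tpp_card_mul_card_add_card_le hT hU
    rw [card_subsig_ownerSystem_mul_compl, Fintype.card_perm, Fintype.card_fin] at h
    omega

end OwnerPairNoThirdK24

end Summit.MatrixMultiplication.MatrixMultiplication.Theorems.ThresholdSubsetTriples
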